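import Literature.IUT.LogVolume.GenuineRamificationBoundsPinned
import HarnessLib

/-!
# Crux `ThetaPartII` (route `IUTThetaPilot`), layer-2 skeleton `Display` RESHAPE-2 (U-branch): the stub `stub_R4` CLOSED

[IUTchIV] Thm. 1.10, proof, Step (iii) (R4), kurims p. 26: "if `e_v ≥ p_v − 1 (> p_v − 2)`, then `p_v ≤ e*_mod·l`", with
"`log(e_v) ≤ −3 + 4·l*_mod`", `l*_mod = log(e*_mod·l)`, `e*_mod = 2^12·3^3·5·e_mod`, `e_mod ≤ d_mod` (p. 22); consumed in
Step (v), p. 28 ("`4(j+1)·ι_{v_ℚ}·l*_mod`"). The registered-to-be stub of crux `stmt-ABC-19678` (skeleton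
`ThetaPartII-Display` RESHAPE-2 / UR2, abc-iut-c312-8; binders EXACTLY those of `Cor22.Thm110Legendre`, body EXACTLY the
tenth conjunct `hR4` of abc-iut-S3's junction `PointDict.hullEstimateOf_BIII_of_towerFacts`):

  `stub_R4 : ∀ P : NFPoint, P ∈ UP → ∀ l : ℕ, l.Prime → 5 ≤ l → Cor22.AdmitsCore P → Cor22.CondP2 P l →
     Cor22.CondP5 P l → Cor22.CondP6 P l → ∀ T : Cor22.ThetaVolumeDatumAt P l, (letI …; ∀ (p : ℕ) [Fact p.Prime],
     p ∈ T.I.supportPrimes → ∀ v : placesOver (fieldOfModuli T.E) p, p − 2 < e(K_{v̲}) →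
       p ≤ 2^12·3^3·5·d_mod·l ∧ 3 + log e(K_{v̲}) ≤ 4·log((2^12·3^3·5·d_mod)·l))`

is PROVED here for EVERY genuine Θ-volume datum of the cell's reading v3 — CLASSICALLY, with print's constant and NO residual
hypothesis (only `P ∈ U_P` of the nine binders is used): abc-iut-S1's `Cor22.ThetaVolumeDatumAt.R4_towerFact`
(`GenuineRamificationBoundsPinned.lean`: `PlaceSection.R4_localFieldFamily_abs` ∘ the two-root inertia bound
`Cor22.ramificationIdx_subThetaField_le` under `IsSubThetaField` ∘ abc-iut-S-d1's `K`-layer lemmas). Classical algebraic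
number theory only; TAKES NO SIDE on [IUTchIII] Cor. 3.12. [claim: Mochizuki2012, status: disputed] for the IUT quotation.
-/

noncomputable section

set_option linter.dupNamespace false

namespace Summit.ABC.ABC.Theorems.ThetaPartII

open Literature.NumberTheory.DiophantineGeometry.GenEll Literature.IUT.LogVolume Literature.IUT.HodgeTheaters
open NumberField IsDedekindDomain Literature.NumberTheory.NumberFields

/-- **`stub_R4` of the `Display` skeleton (RESHAPE-2, U-branch) of crux `ThetaPartII`**: for every `λ`-line point
`P ∈ U_P`, prime `l ≥ 5` with `AdmitsCore`, (P2), (P5), (P6), and EVERY genuine Θ-volume datum `T` at `(P, l)`: at every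
support prime `p` and every place `v ∈ V(F_mod)_p`, `p − 2 < e(K_{v̲}) ⟹ p ≤ 2^12·3^3·5·d_mod·l ∧
3 + log e(K_{v̲}) ≤ 4·log((2^12·3^3·5·d_mod)·l)` — [IUTchIV] Thm. 1.10 (R4) with `e_mod := d_mod`, proved classically
(`Cor22.ThetaVolumeDatumAt.R4_towerFact`). [cite: Mochizuki2012, IUTchIV Thm. 1.10 proof Step (iii) (R4) p. 26] -/
theorem stub_R4 :
    ∀ P : NFPoint, P ∈ UP → ∀ l : ℕ, l.Prime → 5 ≤ l →
      Cor22.AdmitsCore P → Cor22.CondP2 P l → Cor22.CondP5 P l → Cor22.CondP6 P l →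
      ∀ T : Cor22.ThetaVolumeDatumAt P l,
        (letI := T.instFieldF; letI := T.instNumberFieldF; letI := T.instAlgebraF; letI := T.instFieldK
         letI := T.instNumberFieldK; letI := T.instAlgebraK; letI := T.instFieldFbar; letI := T.instAlgebraFbar
         letI := T.instAlgebraKFbar; letI := T.instIsElliptic
         ∀ (p : ℕ) [hp : Fact p.Prime], p ∈ T.I.supportPrimes → ∀ v : placesOver (fieldOfModuli T.E) p,
          p - 2 < absRamificationIdx p ((T.I.σ.localFieldFamily p hp.out).k v) →
            p ≤ 2 ^ 12 * 3 ^ 3 * 5 * Cor22.dmod P * l ∧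
              3 + Real.log (absRamificationIdx p ((T.I.σ.localFieldFamily p hp.out).k v)) ≤
                4 * Real.log (((2 ^ 12 * 3 ^ 3 * 5 * Cor22.dmod P : ℕ) : ℝ) * l)) := by
  intro P hP l _ _ _ _ _ _ T
  exact T.R4_towerFact hP

end Summit.ABC.ABC.Theorems.ThetaPartII

end
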